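import Summits.AtomisticToContinuum.Crystallization.Theorems.FrustratedLawDichotomyStrainedPatchFluxLocal

/-!
# «FluxLocal» sequel: the rule's interface, the lens's RANGE CUT of the site law, candidate rules, order (lens-5 g59, 27623 T-side [CORE-FAR])

Sequel of `…StrainedPatchFluxLocal` (400-line rule, critic ROW 900); decl text self-contained, imports that file only.

* §1 INTERFACE of a flux rule beyond antisymmetry: `HasRange F L` (nothing moves across pairs farther than `L`), `FluxBound F Φ` (the flux on a pair is bounded by
  a profile of its length — (O8)'s uniform `|flux| ≤ Φ` is `Φ ≡ const`), the member's RIM CAPACITY `rimCapacity Φ L z c j = Σ_{k ∉ B(c), r_jk ≤ L} Φ(r_jk)` and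
  ★ `rimLaw_of_fluxBound : FluxBound F Φ → HasRange F L → RimCapacityLaw H Φ L β → RimLaw H F β` — (X3b-R) is GEOMETRY (a shell census of rim bonds per member
  class) once the rule is bounded and of finite range.
* §2 THE LENS'S RANGE CUT of (X3b-S) [finite base range + asymptotic regime + bridge]: the surplus of record splits EXACTLY as `xRec = xBase R_b + xTail R_b`
  (`xRec_eq_base_add_tail`, every `R_b ≥ 0`: `xBase` = the capped surplus of the potential of record truncated to `r ≤ R_b` — level, tight penalty and all;
  `xTail` = half the pair sum over partners beyond `R_b`, i.e. on the TAPER regime `(R_b, 9/2]` of `W₄₅ = effPot w₄₅ ω₄ (3/400)`), and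
  ★ `siteLaw_of_base_of_tail : BaseLaw H F R_b γ A → TailLaw H R_b A → SiteLaw H F γ` with
  (X3b-S₀) `BaseLaw` [CERT on the FINITE `(R_b + L)`-motif · UNDECIDED · INSTRUMENTABLE by (O8′)] — the base part clears `γ + A` after the flux — and
  (X3b-S∞) `TailLaw` [KNOWN-type · ATTACKABLE: packing × `sup |W₄₅|` on `(R_b, 9/2]`, no flux] — the taper part of the share is at least `−A`.
  With `R_b = 3` (the mechanical zone of ROW 1063 item 7: pure Lennard-Jones core, `w₄₅ = 0` below `3`) the fluxed certificate lives on radius-`(3 + L)` motifs.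
* §3 CANDIDATE RULES (definitions + antisymmetry, NO law claimed): BOND-SHARE `shareFlux w ν W z j k = (w j k − 1/2)·W(r_jk)/ν j k` (re-book each bond's energy
  between its ends, `w j k + w k j = 1`, symmetric normaliser `ν`; `…LocalPricing.interactionEnergy_eq_sum_shares` is the global form) and EQUALISING
  `lapFlux λ z j k = λ(r_jk)·(s_k − s_j)` (after it a member holds a `λ`-weighted motif average of the shares; range = support of `λ`).  The ZERO rule: (X3b-S)
  degenerates to sitewise pricing (`siteLaw_zero_iff`), (X3b-R) holds with `β = 0`.
* §4 THE UNIT (critic row 1068): (U2) charged score `xCharged`, its GLOBAL conservation `sum_ballAvg_xCharged_eq` (re-cut harmless upstream),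
  `ballAvg_xCharged_eq_of_divFree` (F-side price), `chargedBallFloor_of_site_of_count` (two pieces, no rim law) — typed for PRICING; the node is (U1).
* §5 THE UNIT OF RECORD (critic row 1070): `Sealed H F` (nothing crosses the 9/5-sphere) ⟹ `RimLaw … 0`; ★★ `coreOff_record_g59_sealed`; the (T-near)/(T-far)
  split `coreOff_of_tnear_of_tfar : BallFloor (TNearClass … a₁) 0 → CoreOffTubeFloor (63/10) (63/10) (24/5) a₁ 0 → [CORE-FAR]` (texture annulus vs re-pinned tube).
No sorry, no new axioms, no cite tokens, no instances / notation / macros; Lean fixes no census number.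
-/

noncomputable section

namespace Summit.AtomisticToContinuum.Crystallization.Theorems.FrustratedLawDichotomyStrainedPatchFluxLocalRules

open scoped BigOperators Classical
open Summit.AtomisticToContinuum.Crystallization.Theorems.FrustratedLawDichotomySchurCut
open Summit.AtomisticToContinuum.Crystallization.Theorems.FrustratedLawDichotomyRuleToolkitGood
open Summit.AtomisticToContinuum.Crystallization.Theorems.FrustratedLawDichotomyMotifLemmas
open Summit.AtomisticToContinuum.Crystallization.Theorems.FrustratedLawDichotomyAveragingCut
open Summit.AtomisticToContinuum.Crystallization.Theorems.FrustratedLawDichotomyAveragingRuleCap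
open Summit.AtomisticToContinuum.Crystallization.Theorems.FrustratedLawDichotomyAveragingRuleTightFree
open Summit.AtomisticToContinuum.Crystallization.Theorems.FrustratedLawDichotomyStrainedPatchHomSplit
open Summit.AtomisticToContinuum.Crystallization.Theorems.FrustratedLawDichotomyStrainedPatchCleanCollar
open Summit.AtomisticToContinuum.Crystallization.Theorems.FrustratedLawDichotomyStrainedPatchPhaseCut
open Summit.AtomisticToContinuum.Crystallization.Theorems.FrustratedLawDichotomyStrainedPatchCoreTube
open Summit.AtomisticToContinuum.Crystallization.Theorems.FrustratedLawDichotomyStrainedPatchStrainBands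
open Summit.AtomisticToContinuum.Crystallization.Theorems.FrustratedLawDichotomyStrainedPatchFluxLocal

/-! ## §1. The rule's interface beyond antisymmetry: finite range and a bond-length flux bound ((O8)'s `|flux| ≤ Φ`); the rim law from geometry -/

/-- **`HasRange F L`** — the rule moves nothing across pairs farther than `L`. -/
def HasRange (F : (M : ℕ) → (Fin M → E3) → Fin M → Fin M → ℝ) (L : ℝ) : Prop :=
  ∀ (M : ℕ) (z : Fin M → E3) (j k : Fin M), L < dist (z j) (z k) → F M z j k = 0

/-- **`FluxBound F Φ`** — the rule's flux on a pair is bounded by a profile of the pair's length (`Φ ≡ const` is (O8)'s uniform bound). -/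
def FluxBound (F : (M : ℕ) → (Fin M → E3) → Fin M → Fin M → ℝ) (Φ : ℝ → ℝ) : Prop :=
  ∀ (M : ℕ) (z : Fin M → E3) (j k : Fin M), |F M z j k| ≤ Φ (dist (z j) (z k))

/-- **`rimCapacity Φ L z c j = Σ_{k ∉ B(c), r_jk ≤ L} Φ(r_jk)`** — the total flux capacity of member `j`'s rim bonds. -/
def rimCapacity (Φ : ℝ → ℝ) (L : ℝ) {M : ℕ} (z : Fin M → E3) (c j : Fin M) : ℝ :=
  ∑ k ∈ (ball (9 / 5) z c)ᶜ.filter (fun k => dist (z j) (z k) ≤ L), Φ (dist (z j) (z k))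

/-- **`RimCapacityLaw H Φ L β` [GEOMETRIC · WEAKER · packing / shell census]** — every member's rim capacity is at most its allowance. -/
def RimCapacityLaw (H : (M : ℕ) → (Fin M → E3) → Fin M → Prop) (Φ : ℝ → ℝ) (L : ℝ) (β : (M : ℕ) → (Fin M → E3) → Fin M → Fin M → ℝ) : Prop :=
  ∀ (M : ℕ) (z : Fin M → E3) (c : Fin M), H M z c → ∀ j ∈ ball (9 / 5) z c, rimCapacity Φ L z c j ≤ β M z c j

/-- ★ (X3b-R) FOLLOWS from the flux bound, the range and the rim-capacity count. [folklore] -/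
theorem rimLaw_of_fluxBound {H : (M : ℕ) → (Fin M → E3) → Fin M → Prop} {F : (M : ℕ) → (Fin M → E3) → Fin M → Fin M → ℝ} {Φ : ℝ → ℝ} {L : ℝ}
    {β : (M : ℕ) → (Fin M → E3) → Fin M → Fin M → ℝ} (hB : FluxBound F Φ) (hL : HasRange F L) (hcap : RimCapacityLaw H Φ L β) :
    RimLaw H F β := by
  intro M z c hH j hj
  refine le_trans ?_ (hcap M z c hH j hj)
  unfold rimCapacity
  rw [← Finset.sum_filter_add_sum_filter_not (ball (9 / 5) z c)ᶜ (fun k => dist (z j) (z k) ≤ L) (fun k => F M z j k)]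
  have h0 : ∑ k ∈ (ball (9 / 5) z c)ᶜ.filter (fun k => ¬dist (z j) (z k) ≤ L), F M z j k = 0 :=
    Finset.sum_eq_zero fun k hk => hL M z j k (not_le.1 (Finset.mem_filter.1 hk).2)
  rw [h0, add_zero]
  exact Finset.sum_le_sum fun k _ => (le_abs_self _).trans (hB M z j k)

/-! ## §2. The lens's range cut of the site law: fluxed BASE RANGE `r ≤ R_b` + floored TAPER REGIME `R_b < r ≤ 9/2` -/

/-- **`xBase R_b`** — the capped surplus of record with the potential TRUNCATED to `r ≤ R_b` (level `e_W`, tight penalty `κ_T = 1/1000` included). -/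
def xBase (Rb : ℝ) (M : ℕ) (z : Fin M → E3) (j : Fin M) : ℝ :=
  surplusCap (1 / 20) (1 / 8) (3 / 2) (fun r => if r ≤ Rb then effPot w₄₅ ω₄ (3 / 400) r else 0) (-(7175 / 10000) + 3 / 400) (1 / 1000) 0 M z j

/-- **`xTail R_b`** — half the pair sum of the potential of record over partners BEYOND `R_b` (the taper regime; zero from `9/2` on). -/
def xTail (Rb : ℝ) (M : ℕ) (z : Fin M → E3) (j : Fin M) : ℝ :=
  (∑ k : Fin M, if dist (z j) (z k) ≤ Rb then 0 else effPot w₄₅ ω₄ (3 / 400) (dist (z j) (z k))) / 2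

/-- ★ THE RANGE CUT IS EXACT: `xRec = xBase R_b + xTail R_b` sitewise, every `R_b ≥ 0`. [folklore] -/
theorem xRec_eq_base_add_tail {Rb : ℝ} (hRb : 0 ≤ Rb) (M : ℕ) (z : Fin M → E3) (j : Fin M) :
    xRec M z j = xBase Rb M z j + xTail Rb M z j := by
  have hsplit : pairSumFeature (effPot w₄₅ ω₄ (3 / 400)) M z j
      = pairSumFeature (fun r => if r ≤ Rb then effPot w₄₅ ω₄ (3 / 400) r else 0) M z j
        + ∑ k : Fin M, (if dist (z j) (z k) ≤ Rb then 0 else effPot w₄₅ ω₄ (3 / 400) (dist (z j) (z k))) := by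
    unfold pairSumFeature
    rw [← Finset.sum_add_distrib]
    refine Finset.sum_congr rfl fun k _ => ?_
    by_cases hk : dist (z j) (z k) ≤ Rb <;> simp [hk]
  simp only [xRec, xBase, xTail, surplusCap]
  rw [hsplit, if_pos hRb]
  ring

/-- The share of a sitewise sum is the sum of the shares. [formal bookkeeping] -/
theorem share_of_add {M : ℕ} (z : Fin M → E3) {x x₁ x₂ : Fin M → ℝ} (h : ∀ j, x j = x₁ j + x₂ j) (j : Fin M) :
    share z x j = share z x₁ j + share z x₂ j := by
  unfold share; rw [h j, add_div]

/-- **(X3b-S₀) `BaseLaw H F R_b γ A` [CERT on the finite `(R_b + L)`-motif · UNDECIDED · INSTRUMENTABLE by (O8′)]** — the BASE-RANGE part of every far member's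
share clears `γ + A` after the rule's net inflow. -/
def BaseLaw (H : (M : ℕ) → (Fin M → E3) → Fin M → Prop) (F : (M : ℕ) → (Fin M → E3) → Fin M → Fin M → ℝ) (Rb : ℝ)
    (γ A : (M : ℕ) → (Fin M → E3) → Fin M → ℝ) : Prop :=
  ∀ (M : ℕ) (z : Fin M → E3) (c : Fin M), H M z c → ∀ j ∈ ball (9 / 5) z c, γ M z j + A M z j ≤ share z (xBase Rb M z) j + fluxDiv (F M z) j

/-- **(X3b-S∞) `TailLaw H R_b A` [KNOWN-type · ATTACKABLE: packing × `sup |W₄₅|` on `(R_b, 9/2]`; no flux]** — the TAPER part of every far member's share is at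
least `−A(z, j)`. -/
def TailLaw (H : (M : ℕ) → (Fin M → E3) → Fin M → Prop) (Rb : ℝ) (A : (M : ℕ) → (Fin M → E3) → Fin M → ℝ) : Prop :=
  ∀ (M : ℕ) (z : Fin M → E3) (c : Fin M), H M z c → ∀ j ∈ ball (9 / 5) z c, -A M z j ≤ share z (xTail Rb M z) j

/-- ★★ BRIDGE of the range cut: (X3b-S₀) ∧ (X3b-S∞) ⟹ (X3b-S). [folklore] -/
theorem siteLaw_of_base_of_tail {H : (M : ℕ) → (Fin M → E3) → Fin M → Prop} {F : (M : ℕ) → (Fin M → E3) → Fin M → Fin M → ℝ} {Rb : ℝ}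
    {γ A : (M : ℕ) → (Fin M → E3) → Fin M → ℝ} (hRb : 0 ≤ Rb) (hB : BaseLaw H F Rb γ A) (hT : TailLaw H Rb A) : SiteLaw H F γ := by
  intro M z c hH j hj
  have h1 := hB M z c hH j hj
  have h2 := hT M z c hH j hj
  rw [share_of_add z (x := xRec M z) (fun j => xRec_eq_base_add_tail hRb M z j) j]
  linarith

/-- ★★ The record through the range cut at the mechanical zone `R_b = 3`: (S₀) ∧ (S∞) ∧ (R) ∧ (C) ⟹ [CORE-FAR] at floor `0`. [folklore] -/
theorem coreOff_record_g59_rangeCut {F : (M : ℕ) → (Fin M → E3) → Fin M → Fin M → ℝ} {γ A : (M : ℕ) → (Fin M → E3) → Fin M → ℝ}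
    {β : (M : ℕ) → (Fin M → E3) → Fin M → Fin M → ℝ} (hA : RuleAntisym F)
    (hB : BaseLaw (FarClass (63 / 10) (63 / 10) (24 / 5) (1 / 100)) F 3 γ A) (hT : TailLaw (FarClass (63 / 10) (63 / 10) (24 / 5) (1 / 100)) 3 A)
    (hR : RimLaw (FarClass (63 / 10) (63 / 10) (24 / 5) (1 / 100)) F β) (hC : CountLaw (FarClass (63 / 10) (63 / 10) (24 / 5) (1 / 100)) γ β 0) :
    CoreOffTubeFloor (63 / 10) (63 / 10) (24 / 5) (1 / 100) 0 :=
  coreOff_record_g59 hA (siteLaw_of_base_of_tail (by norm_num) hB hT) hR hC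

/-- Beyond the range of the potential the taper part vanishes: `TailLaw H (9/2) 0` would be a theorem once `W₄₅ = 0` on `(9/2, ∞)` is invoked; recorded here in the
weaker, hypothesis-carrying form (the vanishing is the tree's `effPot` bookkeeping, not re-proved in this file). [formal bookkeeping] -/
theorem tailLaw_of_vanishing {H : (M : ℕ) → (Fin M → E3) → Fin M → Prop} {Rb : ℝ} (hW : ∀ r, Rb < r → effPot w₄₅ ω₄ (3 / 400) r = 0) :
    TailLaw H Rb (fun _ _ _ => 0) := by
  intro M z c _ j _
  have h0 : xTail Rb M z j = 0 := by
    unfold xTail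
    rw [Finset.sum_eq_zero fun k _ => ?_, zero_div]
    split_ifs with hk
    · rfl
    · exact hW _ (not_le.1 hk)
  simp [share, h0]

/-! ## §3. Candidate rules (definitions and antisymmetry only — which rule, with which floors, is (O8′)'s question) -/

/-- **BOND-SHARE rule** `shareFlux w W ν z j k = (w j k − 1/2) · W(r_jk) / ν j k`: re-book the bond energy `W(r_jk)` between its two ends in proportions
`w j k : w k j` instead of `1/2 : 1/2`, in the normalised currency (`ν` a symmetric normaliser, e.g. the mean of the two ball counts). [definition] -/
def shareFlux (w ν : (M : ℕ) → (Fin M → E3) → Fin M → Fin M → ℝ) (W : ℝ → ℝ) : (M : ℕ) → (Fin M → E3) → Fin M → Fin M → ℝ :=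
  fun M z j k => (w M z j k - 1 / 2) * W (dist (z j) (z k)) / ν M z j k

/-- The bond-share rule is antisymmetric when the shares are complementary and the normaliser symmetric. [folklore] -/
theorem ruleAntisym_shareFlux {w ν : (M : ℕ) → (Fin M → E3) → Fin M → Fin M → ℝ} (W : ℝ → ℝ)
    (hw : ∀ (M : ℕ) (z : Fin M → E3) (j k : Fin M), w M z j k + w M z k j = 1) (hν : ∀ (M : ℕ) (z : Fin M → E3) (j k : Fin M), ν M z j k = ν M z k j) :
    RuleAntisym (shareFlux w ν W) := by
  intro M z j k
  simp only [shareFlux]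
  rw [dist_comm (z k) (z j), hν M z k j, show w M z k j = 1 - w M z j k by linarith [hw M z j k]]
  ring

/-- **EQUALISING rule** `lapFlux λ z j k = λ(r_jk) · (s_k − s_j)`: member `j` receives from richer partners, weighted by bond length; after it a site's value is a
`λ`-weighted motif average of the shares. [definition] -/
def lapFlux (lam : ℝ → ℝ) : (M : ℕ) → (Fin M → E3) → Fin M → Fin M → ℝ :=
  fun M z j k => lam (dist (z j) (z k)) * (share z (xRec M z) k - share z (xRec M z) j)

/-- The equalising rule is antisymmetric for every weight. [folklore] -/
theorem ruleAntisym_lapFlux (lam : ℝ → ℝ) : RuleAntisym (lapFlux lam) := by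
  intro M z j k
  simp only [lapFlux]
  rw [dist_comm (z k) (z j)]
  ring

/-- The equalising rule has range `L` when its weight vanishes beyond `L`. [folklore] -/
theorem hasRange_lapFlux {lam : ℝ → ℝ} {L : ℝ} (h : ∀ r, L < r → lam r = 0) : HasRange (lapFlux lam) L := by
  intro M z j k hjk
  simp [lapFlux, h _ hjk]

/-- The ZERO rule: (X3b-S) degenerates to SITEWISE pricing `γ_j ≤ s_j` (false as a law on frustrated motifs — the reason fluxes exist), (X3b-R) holds with
`β = 0`. [formal bookkeeping] -/
theorem siteLaw_zero_iff (H : (M : ℕ) → (Fin M → E3) → Fin M → Prop) (γ : (M : ℕ) → (Fin M → E3) → Fin M → ℝ) :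
    SiteLaw H (fun _ _ _ _ => 0) γ ↔ ∀ (M : ℕ) (z : Fin M → E3) (c : Fin M), H M z c → ∀ j ∈ ball (9 / 5) z c, γ M z j ≤ share z (xRec M z) j := by
  simp [SiteLaw, fluxDiv]

/-- `rimLaw_zero` (docstring added by the landing lane; see the module docstring). [formal bookkeeping] -/
theorem rimLaw_zero (H : (M : ℕ) → (Fin M → E3) → Fin M → Prop) : RimLaw H (fun _ _ _ _ => 0) (fun _ _ _ _ => 0) := by
  intro M z c _ j _
  simp

/-- The converse bookkeeping: [CORE-FAR] gives back the three pieces for the ZERO rule with the TRIVIAL floor `γ = s` itself — recorded only to show that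
the pieces are not vacuous in the other direction; the content is a floor `γ` that reads the CLASS, not the score. [formal bookkeeping] -/
theorem siteLaw_zero_share (H : (M : ℕ) → (Fin M → E3) → Fin M → Prop) :
    SiteLaw H (fun _ _ _ _ => 0) (fun M z j => share z (xRec M z) j) :=
  (siteLaw_zero_iff H _).2 fun _ _ _ _ _ _ => le_rfl

/-! ## §4. The bookkeeping UNIT (critic row 1068).  (U1) = THIS NODE: the member score `ballAvg (9/5) z (xRec M z) c` is KEPT and the rim law (X3b-R)
IS the member-boundary piece.  (U2) = the flux-CHARGED score, typed below FOR PRICING ONLY (a ROUTE-LEVEL re-cut candidate: the piece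
`StrainedPatchRec` and its upstream `h1` would change with it) — NOT the line node; MustFail MF-10 certifies that it does NOT give [CORE-FAR]. -/

/-- **(U2) `xCharged F`** — the flux-charged site excess `x̃_j := x_j + Σ_k F z j k` (x-currency; the rule acts on the WHOLE configuration). -/
noncomputable def xCharged (F : (M : ℕ) → (Fin M → E3) → Fin M → Fin M → ℝ) (M : ℕ) (z : Fin M → E3) (j : Fin M) : ℝ :=
  xRec M z j + fluxDiv (F M z) j

/-- ★ **(U2) GLOBAL CONSERVATION**: the charged excess has the same configuration total — the flux is free GLOBALLY (antisymmetry). [folklore] -/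
theorem sum_xCharged_eq {F : (M : ℕ) → (Fin M → E3) → Fin M → Fin M → ℝ} (hA : RuleAntisym F) (M : ℕ) (z : Fin M → E3) :
    ∑ j, xCharged F M z j = ∑ j, xRec M z j := by
  have h0 : ∑ j, fluxDiv (F M z) j = 0 := by
    simpa [fluxDiv] using sum_sum_eq_zero_of_antisym (hA M z) Finset.univ
  simp only [xCharged, Finset.sum_add_distrib, h0, add_zero]

/-- ★ **(U2) the absorption total is unchanged**: `Σ_i ballAvg (x̃) i = Σ_i ballAvg (x) i` (sender-normalised double count `sum_ballAvg` of the tree, twice).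
This is the exact sense in which the re-cut is harmless UPSTREAM of the piece; its price is at the piece and on the F-side (memo §0). [folklore] -/
theorem sum_ballAvg_xCharged_eq {F : (M : ℕ) → (Fin M → E3) → Fin M → Fin M → ℝ} (hA : RuleAntisym F) (M : ℕ) (z : Fin M → E3) :
    ∑ i, ballAvg (9 / 5) z (xCharged F M z) i = ∑ i, ballAvg (9 / 5) z (xRec M z) i := by
  rw [sum_ballAvg (by norm_num) z, sum_ballAvg (by norm_num) z, sum_xCharged_eq hA]

/-- Charged = uncharged + the ball average of the divergence (linearity of the sender-normalised average). [formal bookkeeping] -/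
theorem ballAvg_xCharged (F : (M : ℕ) → (Fin M → E3) → Fin M → Fin M → ℝ) (M : ℕ) (z : Fin M → E3) (c : Fin M) :
    ballAvg (9 / 5) z (xCharged F M z) c = ballAvg (9 / 5) z (xRec M z) c + ballAvg (9 / 5) z (fluxDiv (F M z)) c := by
  simp only [ballAvg, xCharged, add_div, Finset.sum_add_distrib]

/-- **(U2)'s F-SIDE PRICE made exact**: on a cluster whose members carry no net divergence the two scores COINCIDE — so hand-1's `HomFloor` and the
near-side floors transfer verbatim exactly on the clusters where the rule is divergence-free on the members (memo §0, price P2b). [formal bookkeeping] -/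
theorem ballAvg_xCharged_eq_of_divFree {F : (M : ℕ) → (Fin M → E3) → Fin M → Fin M → ℝ} {M : ℕ} {z : Fin M → E3} {c : Fin M}
    (h : ∀ j ∈ ball (9 / 5) z c, fluxDiv (F M z) j = 0) : ballAvg (9 / 5) z (xCharged F M z) c = ballAvg (9 / 5) z (xRec M z) c := by
  rw [ballAvg_xCharged, add_eq_left]
  exact Finset.sum_eq_zero fun j hj => by rw [h j hj, zero_div]

/-- **(U2) target shape `ChargedBallFloor H F φ`** — what [CORE-FAR] would BECOME under the re-cut (NOT the record target: MF-10). -/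
def ChargedBallFloor (H : (M : ℕ) → (Fin M → E3) → Fin M → Prop) (F : (M : ℕ) → (Fin M → E3) → Fin M → Fin M → ℝ) (φ : ℝ) : Prop :=
  ∀ (M : ℕ) (z : Fin M → E3) (c : Fin M), H M z c → φ ≤ ballAvg (9 / 5) z (xCharged F M z) c

/-- **(U2-S) `ChargedSiteLaw H F γ`** — per-site floors on the CHARGED shares; under (U2) there is NO rim law (the boundary flux is part of the score). -/
def ChargedSiteLaw (H : (M : ℕ) → (Fin M → E3) → Fin M → Prop) (F : (M : ℕ) → (Fin M → E3) → Fin M → Fin M → ℝ)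
    (γ : (M : ℕ) → (Fin M → E3) → Fin M → ℝ) : Prop :=
  ∀ (M : ℕ) (z : Fin M → E3) (c : Fin M), H M z c → ∀ j ∈ ball (9 / 5) z c, γ M z j ≤ share z (xCharged F M z) j

/-- ★ **(U2) junction**: charged site law ∧ count law (zero allowances) ⟹ charged ball floor — two pieces, no rim law, no antisymmetry needed
PER BALL (antisymmetry is spent once, globally, in `sum_ballAvg_xCharged_eq`). [folklore] -/
theorem chargedBallFloor_of_site_of_count {H : (M : ℕ) → (Fin M → E3) → Fin M → Prop} {F : (M : ℕ) → (Fin M → E3) → Fin M → Fin M → ℝ}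
    {γ : (M : ℕ) → (Fin M → E3) → Fin M → ℝ} {φ : ℝ} (hS : ChargedSiteLaw H F γ) (hC : CountLaw H γ (fun _ _ _ _ => 0) φ) :
    ChargedBallFloor H F φ := by
  intro M z c hH
  rw [ballAvg_eq_sum_share]
  refine (hC M z c hH).trans ?_
  simpa using Finset.sum_le_sum fun j hj => hS M z c hH j hj

/-- (U1) ⟹ (U2) at equal floor wherever the rule is divergence-free on far members (the two units agree there); in general they differ by the
ball average of the divergence (`ballAvg_xCharged`) — which is exactly the rim exchange (U1) must bound and (U2) absorbs. [formal bookkeeping] -/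
theorem chargedBallFloor_of_ballFloor_of_divFree {H : (M : ℕ) → (Fin M → E3) → Fin M → Prop} {F : (M : ℕ) → (Fin M → E3) → Fin M → Fin M → ℝ}
    {φ : ℝ} (h : BallFloor H φ) (hdiv : ∀ (M : ℕ) (z : Fin M → E3) (c : Fin M), H M z c → ∀ j ∈ ball (9 / 5) z c, fluxDiv (F M z) j = 0) :
    ChargedBallFloor H F φ :=
  fun M z c hH => by rw [ballAvg_xCharged_eq_of_divFree (hdiv M z c hH)]; exact h M z c hH

/-! ## §5. The UNIT OF RECORD (critic row 1070): (U1)-SEALED — nothing crosses the `9/5`-sphere of a far cluster; and the (T-near)/(T-far) split of the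
far class by the tube distance `a₁` (texture annulus `1/100 ≤ core_na ≤ a₁` vs the far class at the re-pinned tube radius `a₁`; `a₁` to be read off M3X). -/

/-- **(U1-sealed) `Sealed H F`** — on every `H`-cluster the rule carries NOTHING across the members' `9/5`-sphere (LPC-31: the sealed flux problem loses nothing on the
24 true states in hand; the annulus pays its own rim deficits at `Φ ≥ 10⁻³`). [STRUCTURAL condition on the rule; = (X3b-R) at allowance 0] -/
def Sealed (H : (M : ℕ) → (Fin M → E3) → Fin M → Prop) (F : (M : ℕ) → (Fin M → E3) → Fin M → Fin M → ℝ) : Prop :=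
  ∀ (M : ℕ) (z : Fin M → E3) (c : Fin M), H M z c → ∀ j ∈ ball (9 / 5) z c, ∀ k ∉ ball (9 / 5) z c, F M z j k = 0

/-- A sealed rule satisfies the rim law with ZERO allowance. [formal bookkeeping] -/
theorem rimLaw_of_sealed {H : (M : ℕ) → (Fin M → E3) → Fin M → Prop} {F : (M : ℕ) → (Fin M → E3) → Fin M → Fin M → ℝ} (h : Sealed H F) :
    RimLaw H F (fun _ _ _ _ => 0) := by
  intro M z c hH j hj
  rw [Finset.sum_eq_zero fun k hk => h M z c hH j hj k (Finset.mem_compl.mp hk)]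

/-- ★★ **THE RECORD NODE IN THE UNIT OF RECORD (U1-sealed)**: antisymmetric SEALED rule ∧ (X3b-S) site law on far members ∧ Σ_B γ ≥ 0 ⟹ [CORE-FAR]. [folklore] -/
theorem coreOff_record_g59_sealed {F : (M : ℕ) → (Fin M → E3) → Fin M → Fin M → ℝ} {γ : (M : ℕ) → (Fin M → E3) → Fin M → ℝ} (hA : RuleAntisym F)
    (hSeal : Sealed (FarClass (63 / 10) (63 / 10) (24 / 5) (1 / 100)) F) (hS : SiteLaw (FarClass (63 / 10) (63 / 10) (24 / 5) (1 / 100)) F γ)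
    (hC : CountLaw (FarClass (63 / 10) (63 / 10) (24 / 5) (1 / 100)) γ (fun _ _ _ _ => 0) 0) :
    CoreOffTubeFloor (63 / 10) (63 / 10) (24 / 5) (1 / 100) 0 :=
  coreOff_record_g59 hA hS (rimLaw_of_sealed hSeal) hC

/-- **(T-near a₁) `TNearClass r r₁ ρ ε a₁`** — the TEXTURE ANNULUS of the far class: off the record tube `ε` but inside the wider tube `a₁` (host-anchored boxes). -/
def TNearClass (r r₁ ρ ε a₁ : ℝ) : (M : ℕ) → (Fin M → E3) → Fin M → Prop := fun M z c => FarClass r r₁ ρ ε M z c ∧ NearHomIsoAt ρ a₁ z c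

/-- ★ **(T-near)/(T-far) SPLIT**: the floor on the texture annulus ∧ the floor on the far class AT THE RE-PINNED TUBE RADIUS `a₁` ⟹ the floor on the far class
at `ε` (case split on `NearHomIsoAt ρ a₁`; no monotonicity in the tube radius is used). [folklore] -/
theorem ballFloor_far_split {r r₁ ρ ε a₁ φ : ℝ} (hN : BallFloor (TNearClass r r₁ ρ ε a₁) φ) (hF : BallFloor (FarClass r r₁ ρ a₁) φ) :
    BallFloor (FarClass r r₁ ρ ε) φ := by
  intro M z c hH
  by_cases h : NearHomIsoAt ρ a₁ z c
  · exact hN M z c ⟨hH, h⟩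
  · exact hF M z c ⟨hH.1, hH.2.1, hH.2.2.1, h⟩

/-- ★ [CORE-FAR] ⟸ (T-near a₁) texture-annulus floor ∧ (T-far a₁) = `CoreOffTubeFloor (63/10) (63/10) (24/5) a₁ 0` — the SAME record decl at tube radius `a₁`. [folklore] -/
theorem coreOff_of_tnear_of_tfar {a₁ : ℝ} (hN : BallFloor (TNearClass (63 / 10) (63 / 10) (24 / 5) (1 / 100) a₁) 0)
    (hF : CoreOffTubeFloor (63 / 10) (63 / 10) (24 / 5) a₁ 0) : CoreOffTubeFloor (63 / 10) (63 / 10) (24 / 5) (1 / 100) 0 :=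
  (coreOffTubeFloor_iff_ballFloor _ _ _ _ _).2 (ballFloor_far_split hN ((coreOffTubeFloor_iff_ballFloor _ _ _ _ _).1 hF))

/-- The (T-near) floor in the unit of record: sealed antisymmetric rule ∧ site law on the texture annulus ∧ count ⟹ its ball floor (same junction, smaller class). -/
theorem tnearFloor_of_sealed_site_count {a₁ : ℝ} {F : (M : ℕ) → (Fin M → E3) → Fin M → Fin M → ℝ} {γ : (M : ℕ) → (Fin M → E3) → Fin M → ℝ}
    (hA : RuleAntisym F) (hSeal : Sealed (TNearClass (63 / 10) (63 / 10) (24 / 5) (1 / 100) a₁) F)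
    (hS : SiteLaw (TNearClass (63 / 10) (63 / 10) (24 / 5) (1 / 100) a₁) F γ)
    (hC : CountLaw (TNearClass (63 / 10) (63 / 10) (24 / 5) (1 / 100) a₁) γ (fun _ _ _ _ => 0) 0) :
    BallFloor (TNearClass (63 / 10) (63 / 10) (24 / 5) (1 / 100) a₁) 0 :=
  ballFloor_of_site_of_rim_of_count hA hS (rimLaw_of_sealed hSeal) hC

end Summit.AtomisticToContinuum.Crystallization.Theorems.FrustratedLawDichotomyStrainedPatchFluxLocalRules
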